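import Literature.AnabelianGeometry.EtaleTheta.GalSectThm110iiiEndKnit
import Mathlib.GroupTheory.Commensurable
import HarnessLib

/-!
# [EtTh] Thm. 1.10 (iii) — the CUSP-PAIR TRANSPORT input (b1) reduced to the X-level: `Γ ∘ Inn(c)` carries
# the cuspidal pair of `Ċα` onto that of `Ċβ` once `γ_X` carries `D_{x_α}` onto a conjugate of `D_{x_β}`
# (proof-only)

Mochizuki, *The étale theta function …* [EtTh], Publ. RIMS **45** (2009), Thm. 1.10 (iii) p.256
[cite: MochizukiEtTh2009, Thm 1.10 (iii) p.30]; [GalSect] §4 [cite: MochizukiGalSect2005, §4 p.33].  abc-iut cell,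
layer L2, seat abc-iut-w5-d062 (gen 3); sequel to the END-KNIT `GalSectThm110iiiEndKnit.lean` (p435878), whose
binder `hpair : Cα.pair.map (H.Γ.trans (Mβ.innerAutC c)) = Cβ.pair` (b1) is here DERIVED from inputs of the
shape the tree already uses for Thm. 1.10 (i)/(ii) (abc-iut-w5-d140's row r5 `Thm110DecompTransport`:
"`γ_X` carries the decomposition group of a point to a `Π^tp_X`-conjugate of the corresponding one").
PROOF-ONLY: no definitions, no named facts.

* group theory: `commensurable_of_inf_eq` (two subgroups meeting a finite-index normal subgroup in the same
  subgroup are commensurable), `commensurable_mulAut_smul_iff`, `commensurable_map_equiv_iff`,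
  `eq_of_commensurable_of_terminal` (two commensurable subgroups, each COMMENSURABLY TERMINAL relative to the
  other's elements, are equal);
* `MuTwoSetting.DotCCusp.hpair_of_cuspDecompTransport` — given (x) the X-LEVEL cusp transport
  `γ_X(g_α·D_{x_α}·g_α⁻¹) = σ·(g_β·D_{x_β}·g_β⁻¹)·σ⁻¹` with `σ ∈ Π^tp_{Ċβ}` (as in r5), (ct) commensurable
  terminality of the two cusp decomposition groups `D` inside `Π^tp_Ċ` (print: cuspidal decomposition groups
  are commensurably terminal — census candidate C7d; here BINDERS), (Δ) `Γ(Ker aug_{Cα}) = Ker aug_{Cβ}`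
  ([AbsAnab] Lem. 1.3.8 genre), and the `Thm110Hypothesis` fields `preserves` / `γX_spec`:
  `∃ c ∈ Π^tp_{Ċβ}, Cα.pair.map (Γ ∘ Inn c) = Cβ.pair` — with `c := σ⁻¹` (read in `Π^tp_C`).
  Mechanism: `Γ' := Γ ∘ Inn(σ⁻¹)` matches `Dα ∩ Π^tp_X` with `Dβ ∩ Π^tp_X` (`D_inf_range`, `γX_spec`); `Π^tp_X`
  is normal of index 2 in `Π^tp_C`, so `Γ'(Dα)` and `Dβ` are commensurable subgroups of `Π^tp_{Ċβ}`; two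
  commensurable commensurably-terminal subgroups coincide; the inertia clause follows from (Δ) and `I_eq`.

HONEST FRAMING: every input is a printed inference / cited result, none asserted; typed ≠ proved; no side
taken on [IUTchIII] Cor. 3.12, on which nothing here bears.
-/

namespace Literature.AnabelianGeometry.EtaleTheta

open scoped Pointwise

/-! ### Group theory: commensurability and commensurable terminality -/

section GroupTheory

variable {G G' : Type*} [Group G] [Group G']

/-- `a ∣ b`, `b ≠ 0` ⇒ `a ≠ 0` in `ℕ`. [folklore] -/
private theorem nat_ne_zero_of_dvd {a b : ℕ} (h : a ∣ b) (hb : b ≠ 0) : a ≠ 0 := by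
  rintro rfl
  exact hb (zero_dvd_iff.mp h)

/-- Two subgroups meeting a NORMAL subgroup of FINITE index in the same subgroup are commensurable.
[cite: MochizukiGalSect2005, §4 p.33] -/
theorem commensurable_of_inf_eq {A B R : Subgroup G} [R.Normal] (hR : R.index ≠ 0) (h : A ⊓ R = B ⊓ R) :
    Subgroup.Commensurable A B := by
  have hRB : R.relIndex B ≠ 0 := nat_ne_zero_of_dvd (Subgroup.relIndex_dvd_index_of_normal R B) hR
  have hRA : R.relIndex A ≠ 0 := nat_ne_zero_of_dvd (Subgroup.relIndex_dvd_index_of_normal R A) hR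
  constructor
  · -- `[B : A ⊓ B] ∣ [B : B ⊓ R]`
    have hle : B ⊓ R ≤ A := h ▸ inf_le_left
    have hdvd := Subgroup.relIndex_dvd_of_le_left B hle
    rw [Subgroup.inf_relIndex_left] at hdvd
    exact nat_ne_zero_of_dvd hdvd hRB
  · have hle : A ⊓ R ≤ B := h.symm ▸ inf_le_left
    have hdvd := Subgroup.relIndex_dvd_of_le_left A hle
    rw [Subgroup.inf_relIndex_left] at hdvd
    exact nat_ne_zero_of_dvd hdvd hRA

/-- Commensurability is invariant under an injective homomorphism. [cite: MochizukiGalSect2005, §4 p.33] -/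
theorem commensurable_map_iff_of_injective {f : G →* G'} (hf : Function.Injective f) {H K : Subgroup G} :
    Subgroup.Commensurable (H.map f) (K.map f) ↔ Subgroup.Commensurable H K := by
  unfold Subgroup.Commensurable
  rw [Subgroup.relIndex_map_map_of_injective _ _ hf, Subgroup.relIndex_map_map_of_injective _ _ hf]

/-- Commensurability is invariant under automorphisms (`MulAut`, acting pointwise).
[cite: MochizukiGalSect2005, §4 p.33] -/
theorem commensurable_mulAut_smul_iff (φ : MulAut G) {H K : Subgroup G} :
    Subgroup.Commensurable (φ • H) (φ • K) ↔ Subgroup.Commensurable H K := by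
  rw [Subgroup.pointwise_smul_def, Subgroup.pointwise_smul_def]
  exact commensurable_map_iff_of_injective (fun x y h => φ.injective h)

/-- **Two commensurable subgroups, each commensurably terminal with respect to the other's elements, are
EQUAL** (the mechanism behind "the image of a cusp decomposition group IS the cusp decomposition group").
[cite: MochizukiGalSect2005, §4 p.33] -/
theorem eq_of_commensurable_of_terminal {A B : Subgroup G} (hAB : Subgroup.Commensurable A B)
    (hA : ∀ b ∈ B, Subgroup.Commensurable (MulAut.conj b • A) A → b ∈ A)
    (hB : ∀ a ∈ A, Subgroup.Commensurable (MulAut.conj a • B) B → a ∈ B) : A = B := by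
  apply le_antisymm
  · intro a ha
    apply hB a ha
    -- `aBa⁻¹ ~ aAa⁻¹ = A ~ B`
    have h1 : Subgroup.Commensurable (MulAut.conj a • B) (MulAut.conj a • A) :=
      (commensurable_mulAut_smul_iff _).2 hAB.symm
    rw [GalSect.conj_smul_eq_self_of_mem ha] at h1
    exact h1.trans hAB
  · intro b hb
    apply hA b hb
    have h1 : Subgroup.Commensurable (MulAut.conj b • A) (MulAut.conj b • B) :=
      (commensurable_mulAut_smul_iff _).2 hAB
    rw [GalSect.conj_smul_eq_self_of_mem hb] at h1
    exact h1.trans hAB.symm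

end GroupTheory

/-! ### The cusp-pair transport (b1) from the X-level -/

namespace MuTwoSetting

variable {p : ℕ} [Fact p.Prime] {Mα Mβ : MuTwoSetting p} {εα : Mα.GtpC} {εβ : Mβ.GtpC}
  {hCα : Mα.toThetaSetting.Compat} {hCβ : Mβ.toThetaSetting.Compat}
  {Eα : Mα.toThetaSetting.EtaleThetaData} {Eβ : Mβ.toThetaSetting.EtaleThetaData}
  {γ : Mα.dotC εα ≃ₜ* Mβ.dotC εβ}

/-- `Inn(c)` on a subgroup is `conj c • _`. [cite: MochizukiEtTh2009, Thm 1.10 (iii) p.30] -/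
theorem map_innerAutC (M : MuTwoSetting p) (c : M.GtpC) (S : Subgroup M.GtpC) :
    S.map (M.innerAutC c).toMulEquiv.toMonoidHom = MulAut.conj c • S := by
  ext x
  rw [Subgroup.mem_map, Subgroup.mem_smul_pointwise_iff_exists]
  constructor
  · rintro ⟨y, hy, rfl⟩; exact ⟨y, hy, rfl⟩
  · rintro ⟨y, hy, rfl⟩; exact ⟨y, hy, rfl⟩

/-- Transport of a subgroup along `Γ ∘ Inn(c)`. [cite: MochizukiEtTh2009, Thm 1.10 (iii) p.30] -/
theorem map_trans_innerAutC (Γ : Mα.GtpC ≃ₜ* Mβ.GtpC) (c : Mβ.GtpC) (S : Subgroup Mα.GtpC) :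
    S.map (Γ.trans (Mβ.innerAutC c)).toMulEquiv.toMonoidHom =
      MulAut.conj c • S.map Γ.toMulEquiv.toMonoidHom := by
  rw [← map_innerAutC, Subgroup.map_map]
  rfl

namespace DotCCusp

/-- `Γ(g·D_{x_α}·g⁻¹) = γ_X(…)` read in `Π^tp_{Cβ}` (`γX_spec`). [cite: MochizukiEtTh2009, Thm 1.10 (iii) p.30] -/
theorem map_Γ_map_inclX (H : Thm110Hypothesis εα εβ hCα hCβ Eα Eβ γ) (S : Subgroup Mα.PiTemp) :
    (S.map Mα.inclX).map H.Γ.toMulEquiv.toMonoidHom = (S.map H.γX.toMulEquiv.toMonoidHom).map Mβ.inclX := by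
  rw [Subgroup.map_map, Subgroup.map_map]
  congr 1
  ext x
  exact (H.γX_spec x).symm

/-- `inclX (σ • S) = inclX(σ) • inclX(S)`. [cite: MochizukiEtTh2009, Thm 1.10 (iii) p.30] -/
theorem map_inclX_conj_smul (M : MuTwoSetting p) (σ : M.PiTemp) (S : Subgroup M.PiTemp) :
    (MulAut.conj σ • S).map M.inclX = MulAut.conj (M.inclX σ) • S.map M.inclX :=
  GalSect.map_conj_smul M.inclX σ S

/-- **(b1) FROM THE X-LEVEL.**  If `γ_X` carries the (conjugate of the) decomposition group of the cusp
`x_α` of `X_α` recorded in `Cα` onto a `σ`-conjugate of the one recorded in `Cβ` (`σ ∈ Π^tp_{Xβ}` with image in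
`Π^tp_{Ċβ}`), the two cusp decomposition groups are commensurably terminal in `Π^tp_Ċ`, and `Γ` carries
`Ker(aug_{Cα})` onto `Ker(aug_{Cβ})`, then `Γ ∘ Inn(σ⁻¹)` carries the cuspidal pair of `Ċα` onto that of `Ċβ`
— the binder `hpair` of `thm110iiiGalSect_of_genuineTorsor` / `thm110iiiGalSect_of_transport`.
[cite: MochizukiEtTh2009, Thm 1.10 (iii) p.30] -/
theorem hpair_of_cuspDecompTransport (H : Thm110Hypothesis εα εβ hCα hCβ Eα Eβ γ)
    (Cα : Mα.DotCCusp εα) (Cβ : Mβ.DotCCusp εβ)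
    -- (x) X-level cusp decomposition transport (row-r5 shape for the cusp)
    {σ : Mβ.PiTemp} (hσ : Mβ.inclX σ ∈ Mβ.dotC εβ)
    (hX : (MulAut.conj Cα.conj • Mα.decomp Cα.cusp).map H.γX.toMulEquiv.toMonoidHom =
      MulAut.conj σ • (MulAut.conj Cβ.conj • Mβ.decomp Cβ.cusp))
    -- (ct) commensurable terminality of the cusp decomposition groups in `Π^tp_Ċ`
    (hCTα : ∀ g ∈ Mα.dotC εα, Subgroup.Commensurable (MulAut.conj g • Cα.pair.D) Cα.pair.D → g ∈ Cα.pair.D)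
    (hCTβ : ∀ g ∈ Mβ.dotC εβ, Subgroup.Commensurable (MulAut.conj g • Cβ.pair.D) Cβ.pair.D → g ∈ Cβ.pair.D)
    -- (Δ) `Γ(Δ^tp_{Cα}) = Δ^tp_{Cβ}`
    (hΔ : Cα.augC.ker.map H.Γ.toMulEquiv.toMonoidHom = Cβ.augC.ker) :
    ∃ c ∈ Mβ.dotC εβ, Cα.pair.map (H.Γ.trans (Mβ.innerAutC c)) = Cβ.pair := by
  set c : Mβ.GtpC := (Mβ.inclX σ)⁻¹ with hc
  have hcC : c ∈ Mβ.dotC εβ := (Mβ.dotC εβ).inv_mem hσ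
  refine ⟨c, hcC, ?_⟩
  set Γ' := H.Γ.trans (Mβ.innerAutC c) with hΓ'
  haveI := Mβ.range_inclX_normal
  haveI := Mα.range_inclX_normal
  -- the images of the relevant subgroups under `Γ'`
  have hmapX : Mα.inclX.range.map Γ'.toMulEquiv.toMonoidHom = Mβ.inclX.range := by
    rw [map_trans_innerAutC, H.preserves.map_X]
    exact GalSect.conj_smul_eq_self_of_normal _ c
  have hmapC : (Mα.dotC εα).map Γ'.toMulEquiv.toMonoidHom = Mβ.dotC εβ := by
    rw [map_trans_innerAutC, H.preserves.map_dotC]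
    exact GalSect.conj_smul_eq_self_of_mem hcC
  have hinj : Function.Injective Γ'.toMulEquiv.toMonoidHom := Γ'.toMulEquiv.injective
  set A := Cα.pair.D.map Γ'.toMulEquiv.toMonoidHom with hA
  -- Step 1: `Γ'(Dα) ∩ Π^tp_X = Dβ ∩ Π^tp_X`
  have hAX : A ⊓ Mβ.inclX.range = Cβ.pair.D ⊓ Mβ.inclX.range := by
    rw [Cβ.D_inf_range, hA]
    conv_lhs => rw [← hmapX, ← Subgroup.map_inf _ _ _ hinj, Cα.D_inf_range]
    rw [map_trans_innerAutC, map_Γ_map_inclX, hX, map_inclX_conj_smul, ← mul_smul, ← map_mul, hc,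
      inv_mul_cancel, map_one, one_smul]
  -- Step 2: `Γ'(Dα)` and `Dβ` are commensurable subgroups of `Π^tp_{Ċβ}`
  have hAle : A ≤ Mβ.dotC εβ := by
    rw [hA, ← hmapC]; exact Subgroup.map_mono Cα.D_le
  have hcomm : Subgroup.Commensurable A Cβ.pair.D :=
    commensurable_of_inf_eq (by rw [Mβ.index_range_inclX]; decide) hAX
  -- Step 3: both are commensurably terminal (the one for `A` transported from `α` along `Γ'`)
  have hCTA : ∀ b ∈ Cβ.pair.D, Subgroup.Commensurable (MulAut.conj b • A) A → b ∈ A := by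
    intro b hb hbA
    have hb' : Γ'.symm b ∈ Mα.dotC εα := by
      have : b ∈ (Mα.dotC εα).map Γ'.toMulEquiv.toMonoidHom := hmapC ▸ Cβ.D_le hb
      obtain ⟨y, hy, hyb⟩ := this
      have : Γ'.symm b = y := by rw [← hyb]; exact Γ'.symm_apply_apply y
      rw [this]; exact hy
    have key : Subgroup.Commensurable (MulAut.conj (Γ'.symm b) • Cα.pair.D) Cα.pair.D := by
      rw [← commensurable_map_iff_of_injective hinj, GalSect.map_conj_smul, ← hA]
      have : Γ'.toMulEquiv.toMonoidHom (Γ'.symm b) = b := Γ'.apply_symm_apply b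
      rw [this]
      exact hbA
    have hmem := hCTα _ hb' key
    exact ⟨Γ'.symm b, hmem, Γ'.apply_symm_apply b⟩
  have hD : A = Cβ.pair.D :=
    eq_of_commensurable_of_terminal hcomm hCTA (fun a ha h => hCTβ a (hAle ha) h)
  -- Step 4: the pair
  have hΔ' : Cα.augC.ker.map Γ'.toMulEquiv.toMonoidHom = Cβ.augC.ker := by
    haveI : Cβ.augC.ker.Normal := inferInstance
    rw [map_trans_innerAutC, hΔ]
    exact GalSect.conj_smul_eq_self_of_normal _ c
  refine GalSect.CuspPair.ext' hD ?_
  change Cα.pair.I.map Γ'.toMulEquiv.toMonoidHom = Cβ.pair.I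
  rw [Cα.I_eq, Cβ.I_eq, Subgroup.map_inf _ _ _ hinj, ← hA, hD, hΔ']

end DotCCusp

end MuTwoSetting

/-! ### Plugging into the END-KNIT: Thm. 1.10 (iii) with (b1) read at the X-level -/

section EndKnitX

variable {p : ℕ} [Fact p.Prime] {Mα Mβ : MuTwoSetting p} {εα : Mα.GtpC} {εβ : Mβ.GtpC}
  {hCα : Mα.toThetaSetting.Compat} {hCβ : Mβ.toThetaSetting.Compat}
  {Eα : Mα.toThetaSetting.EtaleThetaData} {Eβ : Mβ.toThetaSetting.EtaleThetaData}
  {γ : Mα.dotC εα ≃ₜ* Mβ.dotC εβ}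

/-- **[EtTh] Thm. 1.10 (iii) (typed, ROW (C)) at the genuine `H¹`-torsor with the cusp-pair transport READ AT
THE X-LEVEL**: `thm110iiiGalSect_of_genuineTorsor` (p435878) with its binder pair `(hc, hpair)` produced by
`hpair_of_cuspDecompTransport`; since the inner correction `c` is now found inside the proof, the inputs (μ)
and (b3) are stated for every `c ∈ Π^tp_{Ċβ}` (they concern THE class transport along `Γ ∘ Inn c`, unique
for each `c`).  Residual named inputs: law, (x) X-level cusp decomposition transport, (ct) commensurable
terminality ×2, (Δ), Kummer identification ∃κ ×2, (μ), (b3) (+ topological side conditions).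
[cite: MochizukiEtTh2009, Thm 1.10 (iii) p.30] -/
theorem thm110iiiGalSect_of_cuspDecompTransport [T1Space Mα.GtpC] [T1Space Mβ.GtpC]
    (H : Thm110Hypothesis εα εβ hCα hCβ Eα Eβ γ)
    (Sα : Mα.StandardData Eα.toKummerData) (Sβ : Mβ.StandardData Eβ.toKummerData)
    (Cα : Mα.DotCCusp εα) (Cβ : Mβ.DotCCusp εβ)
    [IsMulCommutative Cα.pair.I] [IsMulCommutative Cβ.pair.I]
    (hDα : IsClosed (Cα.pair.D : Set Mα.GtpC)) (hIα : IsCompact (Cα.pair.I : Set Mα.GtpC))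
    (hDβ : IsClosed (Cβ.pair.D : Set Mβ.GtpC)) (hIβ : IsCompact (Cβ.pair.I : Set Mβ.GtpC))
    -- (law)
    (hcan : Cα.torsor.IsStructure (GalSect.unitsHat Mα.toThetaSetting.toTemperedCurve) Cα.canonical)
    -- (x) + (ct) + (Δ)
    {σ : Mβ.PiTemp} (hσ : Mβ.inclX σ ∈ Mβ.dotC εβ)
    (hX : (MulAut.conj Cα.conj • Mα.decomp Cα.cusp).map H.γX.toMulEquiv.toMonoidHom =
      MulAut.conj σ • (MulAut.conj Cβ.conj • Mβ.decomp Cβ.cusp))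
    (hCTα : ∀ g ∈ Mα.dotC εα, Subgroup.Commensurable (MulAut.conj g • Cα.pair.D) Cα.pair.D → g ∈ Cα.pair.D)
    (hCTβ : ∀ g ∈ Mβ.dotC εβ, Subgroup.Commensurable (MulAut.conj g • Cβ.pair.D) Cβ.pair.D → g ∈ Cβ.pair.D)
    (hΔ : Cα.augC.ker.map H.Γ.toMulEquiv.toMonoidHom = Cβ.augC.ker)
    -- (gen) Kummer identification of the two cusp torsors
    {S₀α : Subgroup Mα.GtpC} (hS₀α : S₀α ∈ Cα.pair.splittings)
    {S₀β : Subgroup Mβ.GtpC} (hS₀β : S₀β ∈ Cβ.pair.splittings)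
    (hgenα : haveI := Cα.pair.ID_normal
      ∃ κ : GalSect.KxHat Mα.toThetaSetting.toTemperedCurve ≃*
          ↥(ContH1.resKer Cα.pair.ID (⊤ : Subgroup Cα.pair.D)
            (Cα.pair.isClosedComplement_of_mem_splittings hS₀α).le_left),
        ∀ k cl, Cα.torsor.act k cl = (Cα.pair.torsorDataH1 hDα hIα hS₀α).act (κ k) cl)
    (hgenβ : haveI := Cβ.pair.ID_normal
      ∃ κ : GalSect.KxHat Mβ.toThetaSetting.toTemperedCurve ≃*
          ↥(ContH1.resKer Cβ.pair.ID (⊤ : Subgroup Cβ.pair.D)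
            (Cβ.pair.isClosedComplement_of_mem_splittings hS₀β).le_left),
        ∀ k cl, Cβ.torsor.act k cl = (Cβ.pair.torsorDataH1 hDβ hIβ hS₀β).act (κ k) cl)
    -- (μ) and (b3), for the class transport along `Γ ∘ Inn c`, every `c ∈ Π^tp_{Ċβ}`
    (hμ : ∀ c ∈ Mβ.dotC εβ,
      ∀ (δ : GalSect.KxHat Mα.toThetaSetting.toTemperedCurve →* GalSect.KxHat Mβ.toThetaSetting.toTemperedCurve)
        (e : Cα.pair.SplittingClass → Cβ.pair.SplittingClass),
      (∀ (S : Subgroup Mα.GtpC) (hS : S ∈ Cα.pair.splittings),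
        ∃ h', e (GalSect.CuspPair.SplittingClass.mk Cα.pair S hS) =
          GalSect.CuspPair.SplittingClass.mk Cβ.pair
            (S.map (H.Γ.trans (Mβ.innerAutC c)).toMulEquiv.toMonoidHom) h') →
      (∀ (k : GalSect.KxHat Mα.toThetaSetting.toTemperedCurve) (cl : Cα.pair.SplittingClass),
        e (Cα.torsor.act k cl) = Cβ.torsor.act (δ k) (e cl)) →
      Mα.muTwoHat.map δ = Mβ.muTwoHat)
    (hecan : ∀ c ∈ Mβ.dotC εβ, ∀ (e : Cα.pair.SplittingClass → Cβ.pair.SplittingClass),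
      (∀ (S : Subgroup Mα.GtpC) (hS : S ∈ Cα.pair.splittings),
        ∃ h', e (GalSect.CuspPair.SplittingClass.mk Cα.pair S hS) =
          GalSect.CuspPair.SplittingClass.mk Cβ.pair
            (S.map (H.Γ.trans (Mβ.innerAutC c)).toMulEquiv.toMonoidHom) h') →
      e '' Cα.canonical ⊆ Cβ.canonical) :
    Thm110iiiGalSect H Sα Sβ Cα Cβ := by
  obtain ⟨c, hc, hpair⟩ := Cα.hpair_of_cuspDecompTransport H Cβ hσ hX hCTα hCTβ hΔ
  exact thm110iiiGalSect_of_genuineTorsor H Sα Sβ Cα Cβ hDα hIα hDβ hIβ hcan hc hpair hS₀α hS₀β hgenα hgenβ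
    (hμ c hc) (hecan c hc)

end EndKnitX

end Literature.AnabelianGeometry.EtaleTheta
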